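import Literature.Computability.MetaComplexity.McKayMurrayWilliams2019.UniformStreaming
import Literature.Computability.MetaComplexity.MCSPProofs
import Literature.Computability.Complexity.SearchToDecision
import Literature.Computability.Complexity.CodeFPStringKit
import Literature.Computability.Complexity.CodeFPBudgets
import Literature.Computability.Complexity.LengthCompare
import Literature.Computability.Complexity.StringCopy
import Literature.Computability.Complexity.StringEquality
import Literature.Computability.Complexity.ExpClosure
import HarnessLib

/-!
# McKay–Murray–Williams 2019, Theorem 1.3 for polynomially honest size functions — proofs

D. M. McKay, C. D. Murray, R. R. Williams, *Weak lower bounds on resource-bounded compression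
imply strong separations of complexity classes*, STOC 2019, 1215–1225,
doi:10.1145/3313276.3316396 — Theorem 1.3 (with Theorem 1.2 and §5): if there is a
time-constructible `s` such that `MCSP[s(n)]` has no `poly(s(n))`-space streaming algorithm with
`poly(s(n))` update time, then `P ≠ NP`.

`UniformStreaming.lean` renders the statement faithfully as the named fact `thm13` over the
uniform streaming class `USTREAM` (ONE update machine for all input lengths, given `N`).  This file
PROVES the statement for every size function `s` that is computable in polynomial time from unary
to unary (`CodeFP unE unE s`) and satisfies `n ≤ s n` — in particular for every `s(n) = n ^ k`,
`k ≥ 1`, the range in which the theorem is used (`thm13_pow`):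

* `MCSPSize_mem_USTREAM_of_NP_subset_P`: if `NP ⊆ P` then `MCSP[s] ∈ USTREAM[poly s, poly s]`;
* `P_ne_NP_of_streamingLowerBound_of_codeFP`, `thm13_of_codeFP`, `thm13_pow`: the magnification
  statement (contrapositive).

What is reproduced is the STATEMENT of [MMW19, Thm. 1.3] on this range, and the proof follows
the paper's own streaming algorithm (§4, Algorithm 1, proving Thm. 1.2): keep a small circuit
consistent with the prefix read and MERGE it with the next bits ("Stream-Merge", there answered
by `Õ(t)` calls to a `Σ₃SAT^A` oracle, which §5 removes under `P = NP`).  The rendering here takes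
`t = 1` bit per iteration, stores the circuit as a clean straight-line program `D`
(`CircuitEvalPrograms.lean`) with at most `s(n)` gate tableaux, and replaces the oracle calls
directly by the polynomial-time witness search available under `NP ⊆ P`
(`exists_searchFn_of_NP_subset_P`, [Arora–Barak 2009, Thm. 2.18]) for the `NP ⊆ P`-decidable
relation "`D'` is clean, small, agrees with the new bit, and agrees with `D` on all earlier
positions" (the last conjunct is a `coNP` condition, in `P` under the hypothesis) — so no
oracle machines are needed.
Completeness of the invariant uses an optimal circuit (`exists_circuit_size_eq_circuitSizeOver`)
and its program (`vmSpec_progOf`, `vmSpec_rotCode_proj`); soundness is Theorem R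
(`exists_circuit_evalFn`).  The state has length `O((s(n)+n)²)` and the update / report maps are in
`FP` on inputs of length `poly(s(n))` (using `n ≤ s(n)`), whence the `s(log₂ N)^c + c` bounds.

References: McKay–Murray–Williams 2019 (above), Thm. 1.2, Thm. 1.3, §4 (Algorithm 1,
Stream-Merge), §5; L. Chen, S. Hirahara,
I. C. Oliveira, J. Pich, N. Rajgopal, R. Santhanam, *Beyond natural proofs: hardness magnification
and locality*, ITCS 2020 / arXiv:1911.08297, §1.1 (the streaming model); S. Arora, B. Barak,
*Computational Complexity: A Modern Approach*, CUP 2009, Thm. 2.18 (search to decision).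
-/

noncomputable section

open Computability

namespace Literature.Computability.MetaComplexity.McKayMurrayWilliams2019

open Literature.Computability.Complexity Literature.Computability.Complexity.CircEval
open Literature.Computability.MetaComplexity CodeFP MCSPVerif Polynomial

/-- **[MMW19, Thm. 1.2/1.3, the `P = NP` branch] for polynomially honest `s`.**  If `NP ⊆ P`,
`s` is polynomial-time computable (unary to unary) and `n ≤ s n`, then `MCSP[s]` is decided by a
uniform one-pass streaming algorithm with empty initial state, space `s(log₂ N)^c + c` and update /
report time `s(log₂ N)^c + c` for some constant `c`.
[cite: McKayMurrayWilliams2019, Thm. 1.3] [cite: AroraBarakCC2009, Thm. 2.18] -/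
theorem MCSPSize_mem_USTREAM_of_NP_subset_P {s : ℕ → ℕ}
    (hNP : Nondeterministic.NP ⊆ Classes.P) (hs : CodeFP unE unE s) (hsn : ∀ n, n ≤ s n) :
    ∃ c : ℕ, MCSPSize s ∈
      USTREAM (fun N => s (Nat.log 2 N) ^ c + c) (fun N => s (Nat.log 2 N) ^ c + c) := by
  classical
  /- Step 0: the row evaluation `ev n D j` (run the program `D` on the `n` low bits of `j`), the
  length cap, and their codes. -/
  obtain ⟨ev, hev⟩ : ∃ ev : ℕ → List Bool → ℕ → List Bool,
      ev = fun n D j => evalFn (boolPair ((natE j).takeD n false) D) := ⟨_, rfl⟩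
  obtain ⟨cap, hcap⟩ : ∃ cap : ℕ → ℕ → ℕ,
      cap = fun n σ => (σ + 1) * (8 * (n + σ) + 10) + 2 * n := ⟨_, rfl⟩
  have evC : CodeFP (pairE unE (pairE strE natE)) strE
      (fun p : ℕ × List Bool × ℕ => ev p.1 p.2.1 p.2.2) := by
    have h0 : CodeFP (pairE strE strE) strE (fun p : List Bool × List Bool => evalFn (boolPair p.1 p.2)) :=
      ⟨evalFn, evalFn_mem_FP, fun _ => rfl⟩
    rw [hev]
    exact (h0.comp ((CodeFP.takeD.comp ((CodeFP.fst unE (pairE strE natE)).pair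
      (strOfNat.comp (CodeFP.snd unE (pairE strE natE)).snd'))).pair
      (CodeFP.snd unE (pairE strE natE)).fst') :)
  have cleanC : CodeFP strE bitE isClean :=
    ⟨cleanT.eval, cleanT_mem_FP, fun D => by show cleanT.eval D = [isClean D]; rw [cleanT_eval]⟩
  have tabC : CodeFP strE unE tabCount :=
    ⟨tabMarksT.eval, tabMarksT_mem_FP, fun D => by
      show tabMarksT.eval D = unE (tabCount D); rw [tabMarksT_eval, unE_eq_ones]⟩
  have capC : CodeFP (pairE unE unE) natE (fun p : ℕ × ℕ => cap p.1 p.2) := by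
    have a : CodeFP (pairE unE unE) natE (fun p : ℕ × ℕ => p.1) :=
      (natOfUn.comp (CodeFP.fst unE unE)).congr fun _ => rfl
    have b : CodeFP (pairE unE unE) natE (fun p : ℕ × ℕ => p.2) :=
      (natOfUn.comp (CodeFP.snd unE unE)).congr fun _ => rfl
    rw [hcap]
    exact (natAdd.comp₂
      (natMul.comp₂ (natAdd.comp₂ b (CodeFP.const _ 1))
        (natAdd.comp₂ (natMul.comp₂ (CodeFP.const _ 8) (natAdd.comp₂ a b)) (CodeFP.const _ 10)))
      (natMul.comp₂ (CodeFP.const _ 2) a) :)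
  -- projections of the typed search instance `u = (n, σ, i, D, b)`
  have u_n : CodeFP (pairE unE (pairE unE (pairE natE (pairE strE bitE)))) unE
      (fun t : ℕ × ℕ × ℕ × List Bool × Bool => t.1) := CodeFP.fst _ _
  have u_σ : CodeFP (pairE unE (pairE unE (pairE natE (pairE strE bitE)))) unE
      (fun t : ℕ × ℕ × ℕ × List Bool × Bool => t.2.1) := (CodeFP.snd _ _).fst'
  have u_i : CodeFP (pairE unE (pairE unE (pairE natE (pairE strE bitE)))) natE
      (fun t : ℕ × ℕ × ℕ × List Bool × Bool => t.2.2.1) := (CodeFP.snd _ _).snd'.fst'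
  have u_D : CodeFP (pairE unE (pairE unE (pairE natE (pairE strE bitE)))) strE
      (fun t : ℕ × ℕ × ℕ × List Bool × Bool => t.2.2.2.1) := (CodeFP.snd _ _).snd'.snd'.fst'
  have u_b : CodeFP (pairE unE (pairE unE (pairE natE (pairE strE bitE)))) bitE
      (fun t : ℕ × ℕ × ℕ × List Bool × Bool => t.2.2.2.2) := (CodeFP.snd _ _).snd'.snd'.snd'
  /- Step 1: the inner `NP` language "some earlier row of `D'` differs from that of `D`". -/
  obtain ⟨r1, hr1⟩ : ∃ r1 : ((ℕ × ℕ × ℕ × List Bool × Bool) × List Bool) × List Bool → Bool,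
      r1 = fun q => decide (bitsToNat q.2 < q.1.1.2.2.1) &&
        !decide (ev q.1.1.1 q.1.2 (bitsToNat q.2) = ev q.1.1.1 q.1.1.2.2.2.1 (bitsToNat q.2)) :=
    ⟨_, rfl⟩
  have r1C : CodeFP (pairE (pairE (pairE unE (pairE unE (pairE natE (pairE strE bitE)))) strE) strE)
      bitE r1 := by
    have qt : CodeFP (pairE (pairE (pairE unE (pairE unE (pairE natE (pairE strE bitE)))) strE) strE)
        (pairE unE (pairE unE (pairE natE (pairE strE bitE))))
        (fun q : ((ℕ × ℕ × ℕ × List Bool × Bool) × List Bool) × List Bool => q.1.1) :=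
      (CodeFP.fst _ _).fst'
    have qD' : CodeFP (pairE (pairE (pairE unE (pairE unE (pairE natE (pairE strE bitE)))) strE) strE)
        strE (fun q : ((ℕ × ℕ × ℕ × List Bool × Bool) × List Bool) × List Bool => q.1.2) :=
      (CodeFP.fst _ _).snd'
    have qj : CodeFP (pairE (pairE (pairE unE (pairE unE (pairE natE (pairE strE bitE)))) strE) strE)
        natE (fun q : ((ℕ × ℕ × ℕ × List Bool × Bool) × List Bool) × List Bool => bitsToNat q.2) :=
      strVal.comp (CodeFP.snd _ _)
    rw [hr1]
    exact ((natLt.comp₂ qj (u_i.comp qt)).and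
      (((CodeFP.eq (eα := strE) Function.injective_id).comp₂
        (evC.comp ((u_n.comp qt).pair (qD'.pair qj)))
        (evC.comp ((u_n.comp qt).pair ((u_D.comp qt).pair qj)))).not) :)
  obtain ⟨F₁, hF₁, hF₁q⟩ := r1C
  obtain ⟨R₁, hR₁⟩ : ∃ R₁ : Language Bool, R₁ = {y | F₁ y = (fun _ => [true]) y} := ⟨_, rfl⟩
  have hR₁P : R₁ ∈ Classes.P := by
    rw [hR₁]; exact setOf_apply_eq_apply_mem_P hF₁ (const_mem_FP [true])
  obtain ⟨INNER, hIN⟩ : ∃ S : Language Bool,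
      S = {z | ∃ w : List Bool, w.length ≤ (X : Polynomial ℕ).eval z.length ∧ boolPair z w ∈ R₁} :=
    ⟨_, rfl⟩
  have hINP : INNER ∈ Classes.P := by
    refine hNP ?_
    rw [hIN]
    exact ⟨R₁, hR₁P, X, fun z => Iff.rfl⟩
  have hmemR₁ : ∀ (n σ i : ℕ) (D : List Bool) (b : Bool) (D' w : List Bool),
      boolPair (boolPair (pairE unE (pairE unE (pairE natE (pairE strE bitE))) (n, σ, i, D, b)) D') w
        ∈ R₁ ↔ bitsToNat w < i ∧ ev n D' (bitsToNat w) ≠ ev n D (bitsToNat w) := by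
    intro n σ i D b D' w
    have h : F₁ (boolPair (boolPair (pairE unE (pairE unE (pairE natE (pairE strE bitE)))
        (n, σ, i, D, b)) D') w) = [r1 (((n, σ, i, D, b), D'), w)] := hF₁q (((n, σ, i, D, b), D'), w)
    rw [hR₁]
    change F₁ _ = [true] ↔ _
    rw [h, hr1]
    simp
  have hINiff : ∀ (n σ i : ℕ) (D : List Bool) (b : Bool) (D' : List Bool),
      boolPair (pairE unE (pairE unE (pairE natE (pairE strE bitE))) (n, σ, i, D, b)) D' ∈ INNER ↔
        ∃ j < i, ev n D' j ≠ ev n D j := by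
    intro n σ i D b D'
    rw [hIN]
    change (∃ w : List Bool, w.length ≤ (X : Polynomial ℕ).eval (boolPair _ D').length ∧
      boolPair (boolPair _ D') w ∈ R₁) ↔ _
    simp only [eval_X, hmemR₁]
    constructor
    · rintro ⟨w, -, hlt, hne⟩
      exact ⟨bitsToNat w, hlt, hne⟩
    · rintro ⟨j, hj, hne⟩
      refine ⟨natE j, ?_, by simpa using hj, by simpa using hne⟩
      have h1 : (natE j).length ≤ (natE i).length := by
        rw [length_natE, length_natE]; exact Nat.size_le_size hj.le
      simp only [pairE_apply, length_boolPair, length_unE]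
      omega
  /- Step 2: the `P` language of good successors
  `GOOD = {⟨u, D'⟩ | D' clean ∧ #TAB D' ≤ σ ∧ |D'| ≤ cap ∧ row_i(D') = b ∧ ∀ j < i, row_j D' = row_j D}`. -/
  have hINC : CodeFP strE bitE (fun z => INNER.boolIndicator z) :=
    ⟨fun z => encodeBool (INNER.boolIndicator z), indicatorFn_mem_FP hINP, fun _ => rfl⟩
  obtain ⟨gd, hgd⟩ : ∃ gd : (ℕ × ℕ × ℕ × List Bool × Bool) × List Bool → Bool,
      gd = fun q => isClean q.2 && decide (tabCount q.2 ≤ q.1.2.1) &&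
        decide (q.2.length ≤ cap q.1.1 q.1.2.1) && decide (ev q.1.1 q.2 q.1.2.2.1 = [q.1.2.2.2.2]) &&
        !INNER.boolIndicator
          (boolPair (pairE unE (pairE unE (pairE natE (pairE strE bitE))) q.1) q.2) :=
    ⟨_, rfl⟩
  have gdC : CodeFP (pairE (pairE unE (pairE unE (pairE natE (pairE strE bitE)))) strE) bitE gd := by
    have qt : CodeFP (pairE (pairE unE (pairE unE (pairE natE (pairE strE bitE)))) strE)
        (pairE unE (pairE unE (pairE natE (pairE strE bitE))))
        (fun q : (ℕ × ℕ × ℕ × List Bool × Bool) × List Bool => q.1) := CodeFP.fst _ _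
    have qD : CodeFP (pairE (pairE unE (pairE unE (pairE natE (pairE strE bitE)))) strE) strE
        (fun q : (ℕ × ℕ × ℕ × List Bool × Bool) × List Bool => q.2) := CodeFP.snd _ _
    have qcode : CodeFP (pairE (pairE unE (pairE unE (pairE natE (pairE strE bitE)))) strE) strE
        (fun q : (ℕ × ℕ × ℕ × List Bool × Bool) × List Bool =>
          boolPair (pairE unE (pairE unE (pairE natE (pairE strE bitE))) q.1) q.2) :=
      (CodeFP.id _).recodeOut fun _ => rfl
    have b2s : CodeFP bitE strE (fun b : Bool => [b]) := (CodeFP.id bitE).recodeOut fun _ => rfl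
    rw [hgd]
    exact (((((cleanC.comp qD).and (natLeUn.comp₂ (natOfUn.comp (tabC.comp qD)) (u_σ.comp qt))).and
      (natLe.comp₂ (strNatLength.comp qD) (capC.comp ((u_n.comp qt).pair (u_σ.comp qt))))).and
      ((CodeFP.eq (eα := strE) Function.injective_id).comp₂
        (evC.comp ((u_n.comp qt).pair (qD.pair (u_i.comp qt)))) (b2s.comp (u_b.comp qt)))).and
      (hINC.comp qcode).not :)
  obtain ⟨F, hF, hFq⟩ := gdC
  obtain ⟨GOOD, hGOOD⟩ : ∃ G : Language Bool, G = {z | F z = (fun _ => [true]) z} := ⟨_, rfl⟩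
  have hGP : GOOD ∈ Classes.P := by
    rw [hGOOD]; exact setOf_apply_eq_apply_mem_P hF (const_mem_FP [true])
  have hGiff : ∀ (n σ i : ℕ) (D : List Bool) (b : Bool) (D' : List Bool),
      boolPair (pairE unE (pairE unE (pairE natE (pairE strE bitE))) (n, σ, i, D, b)) D' ∈ GOOD ↔
        isClean D' = true ∧ tabCount D' ≤ σ ∧ D'.length ≤ cap n σ ∧ ev n D' i = [b] ∧
          ∀ j < i, ev n D' j = ev n D j := by
    intro n σ i D b D'
    have h : F (boolPair (pairE unE (pairE unE (pairE natE (pairE strE bitE))) (n, σ, i, D, b)) D') =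
        [gd ((n, σ, i, D, b), D')] := hFq ((n, σ, i, D, b), D')
    have hnot : ((!INNER.boolIndicator (boolPair (pairE unE (pairE unE (pairE natE (pairE strE bitE)))
        (n, σ, i, D, b)) D')) = true) ↔ ∀ j < i, ev n D' j = ev n D j := by
      have e0 : ¬ (boolPair (pairE unE (pairE unE (pairE natE (pairE strE bitE))) (n, σ, i, D, b)) D'
          ∈ INNER) ↔ INNER.boolIndicator (boolPair (pairE unE (pairE unE (pairE natE (pairE strE bitE)))
          (n, σ, i, D, b)) D') = false := Set.notMem_iff_boolIndicator _ _
      have e : ((!INNER.boolIndicator (boolPair (pairE unE (pairE unE (pairE natE (pairE strE bitE)))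
          (n, σ, i, D, b)) D')) = true) ↔
          ¬ (boolPair (pairE unE (pairE unE (pairE natE (pairE strE bitE))) (n, σ, i, D, b)) D' ∈ INNER) := by
        rw [e0]
        cases INNER.boolIndicator (boolPair (pairE unE (pairE unE (pairE natE (pairE strE bitE)))
          (n, σ, i, D, b)) D') <;> simp
      rw [e, hINiff]
      simp only [not_exists, not_and, ne_eq, not_not, iff_self]
    rw [hGOOD]
    change F _ = [true] ↔ _
    rw [h, hgd]
    simp only [List.cons.injEq, and_true, Bool.and_eq_true, decide_eq_true_eq, hnot, and_assoc]
  /- Step 3: the witness search (available under `NP ⊆ P`). -/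
  obtain ⟨g, hgFP, hg⟩ := exists_searchFn_of_NP_subset_P hNP hGP (8 * X ^ 2 + 20 * X + 10)
  have hcapW : ∀ (n σ i : ℕ) (D : List Bool) (b : Bool),
      cap n σ ≤ (8 * X ^ 2 + 20 * X + 10 : Polynomial ℕ).eval
        (pairE unE (pairE unE (pairE natE (pairE strE bitE))) (n, σ, i, D, b)).length := by
    intro n σ i D b
    have hL : n + σ + 1 ≤ (pairE unE (pairE unE (pairE natE (pairE strE bitE))) (n, σ, i, D, b)).length := by
      simp only [pairE_apply, length_boolPair, length_unE]; omega
    generalize (pairE unE (pairE unE (pairE natE (pairE strE bitE))) (n, σ, i, D, b)).length = L at hL ⊢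
    rw [hcap]
    simp only [eval_add, eval_mul, eval_pow, eval_X, eval_ofNat]
    have h1 : (σ + 1) * (8 * (n + σ) + 10) ≤ L * (8 * L + 10) := Nat.mul_le_mul (by omega) (by omega)
    have h2 : L * (8 * L + 10) = 8 * L ^ 2 + 10 * L := by ring
    omega
  /- Step 4: the typed update step, the update map and the accepting predicate, and their codes. -/
  obtain ⟨stepT, hstepT⟩ : ∃ stepT : ℕ → ℕ → Bool × ℕ × List Bool → Bool → Bool × ℕ × List Bool,
      stepT = fun n σ t b =>
        if t.1 = true then
          (if GOOD.boolIndicator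
              (boolPair (pairE unE (pairE unE (pairE natE (pairE strE bitE))) (n, σ, t.2.1, t.2.2, b))
                (g (pairE unE (pairE unE (pairE natE (pairE strE bitE))) (n, σ, t.2.1, t.2.2, b)))) = true
            then (true, t.2.1 + 1,
              g (pairE unE (pairE unE (pairE natE (pairE strE bitE))) (n, σ, t.2.1, t.2.2, b)))
            else (false, t.2.1 + 1, []))
        else (false, t.2.1 + 1, []) := ⟨_, rfl⟩
  have stepC : CodeFP (pairE (pairE unE unE) (pairE (pairE bitE (pairE natE strE)) bitE))
      (pairE bitE (pairE natE strE))
      (fun q : (ℕ × ℕ) × (Bool × ℕ × List Bool) × Bool => stepT q.1.1 q.1.2 q.2.1 q.2.2) := by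
    have qn : CodeFP (pairE (pairE unE unE) (pairE (pairE bitE (pairE natE strE)) bitE)) unE
        (fun q : (ℕ × ℕ) × (Bool × ℕ × List Bool) × Bool => q.1.1) := (CodeFP.fst _ _).fst'
    have qσ : CodeFP (pairE (pairE unE unE) (pairE (pairE bitE (pairE natE strE)) bitE)) unE
        (fun q : (ℕ × ℕ) × (Bool × ℕ × List Bool) × Bool => q.1.2) := (CodeFP.fst _ _).snd'
    have qa : CodeFP (pairE (pairE unE unE) (pairE (pairE bitE (pairE natE strE)) bitE)) bitE
        (fun q : (ℕ × ℕ) × (Bool × ℕ × List Bool) × Bool => q.2.1.1) := (CodeFP.snd _ _).fst'.fst'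
    have qi : CodeFP (pairE (pairE unE unE) (pairE (pairE bitE (pairE natE strE)) bitE)) natE
        (fun q : (ℕ × ℕ) × (Bool × ℕ × List Bool) × Bool => q.2.1.2.1) :=
      (CodeFP.snd _ _).fst'.snd'.fst'
    have qD : CodeFP (pairE (pairE unE unE) (pairE (pairE bitE (pairE natE strE)) bitE)) strE
        (fun q : (ℕ × ℕ) × (Bool × ℕ × List Bool) × Bool => q.2.1.2.2) :=
      (CodeFP.snd _ _).fst'.snd'.snd'
    have qb : CodeFP (pairE (pairE unE unE) (pairE (pairE bitE (pairE natE strE)) bitE)) bitE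
        (fun q : (ℕ × ℕ) × (Bool × ℕ × List Bool) × Bool => q.2.2) := (CodeFP.snd _ _).snd'
    have qu : CodeFP (pairE (pairE unE unE) (pairE (pairE bitE (pairE natE strE)) bitE))
        (pairE unE (pairE unE (pairE natE (pairE strE bitE))))
        (fun q : (ℕ × ℕ) × (Bool × ℕ × List Bool) × Bool => (q.1.1, q.1.2, q.2.1.2.1, q.2.1.2.2, q.2.2)) :=
      qn.pair (qσ.pair (qi.pair (qD.pair qb)))
    have quS : CodeFP (pairE (pairE unE unE) (pairE (pairE bitE (pairE natE strE)) bitE)) strE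
        (fun q : (ℕ × ℕ) × (Bool × ℕ × List Bool) × Bool =>
          pairE unE (pairE unE (pairE natE (pairE strE bitE))) (q.1.1, q.1.2, q.2.1.2.1, q.2.1.2.2, q.2.2)) :=
      qu.recodeOut fun _ => rfl
    have gC : CodeFP strE strE g := ⟨g, hgFP, fun _ => rfl⟩
    have pairS : CodeFP (pairE strE strE) strE (fun p : List Bool × List Bool => boolPair p.1 p.2) :=
      (CodeFP.id _).recodeOut fun _ => rfl
    have hGC : CodeFP strE bitE (fun z => GOOD.boolIndicator z) :=
      ⟨fun z => encodeBool (GOOD.boolIndicator z), indicatorFn_mem_FP hGP, fun _ => rfl⟩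
    have testC : CodeFP (pairE (pairE unE unE) (pairE (pairE bitE (pairE natE strE)) bitE)) bitE
        (fun q : (ℕ × ℕ) × (Bool × ℕ × List Bool) × Bool => GOOD.boolIndicator (boolPair
          (pairE unE (pairE unE (pairE natE (pairE strE bitE))) (q.1.1, q.1.2, q.2.1.2.1, q.2.1.2.2, q.2.2))
          (g (pairE unE (pairE unE (pairE natE (pairE strE bitE)))
            (q.1.1, q.1.2, q.2.1.2.1, q.2.1.2.2, q.2.2))))) :=
      hGC.comp (pairS.comp (quS.pair (gC.comp quS)))
    have iC : CodeFP (pairE (pairE unE unE) (pairE (pairE bitE (pairE natE strE)) bitE)) natE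
        (fun q : (ℕ × ℕ) × (Bool × ℕ × List Bool) × Bool => q.2.1.2.1 + 1) :=
      natAdd.comp₂ qi (CodeFP.const _ 1)
    have deadC : CodeFP (pairE (pairE unE unE) (pairE (pairE bitE (pairE natE strE)) bitE))
        (pairE bitE (pairE natE strE))
        (fun q : (ℕ × ℕ) × (Bool × ℕ × List Bool) × Bool => (false, q.2.1.2.1 + 1, ([] : List Bool))) :=
      (CodeFP.const _ false).pair (iC.pair (CodeFP.const _ ([] : List Bool)))
    have aliveC : CodeFP (pairE (pairE unE unE) (pairE (pairE bitE (pairE natE strE)) bitE))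
        (pairE bitE (pairE natE strE))
        (fun q : (ℕ × ℕ) × (Bool × ℕ × List Bool) × Bool => (true, q.2.1.2.1 + 1,
          g (pairE unE (pairE unE (pairE natE (pairE strE bitE)))
            (q.1.1, q.1.2, q.2.1.2.1, q.2.1.2.2, q.2.2)))) :=
      (CodeFP.const _ true).pair (iC.pair (gC.comp quS))
    rw [hstepT]
    exact (qa.ite (testC.ite aliveC deadC) deadC :)
  -- `n = log₂ N` from `N`, in unary
  have hlogsize : ∀ N : ℕ, Nat.log 2 N = Nat.size N - 1 := by
    intro N
    rcases Nat.eq_zero_or_pos N with rfl | hN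
    · simp
    · have h1 : Nat.log 2 N < Nat.size N := Nat.lt_size.2 (Nat.pow_log_le_self 2 hN.ne')
      have h2 : Nat.size N ≤ Nat.log 2 N + 1 := Nat.size_le.2 (Nat.lt_pow_succ_log_self one_lt_two N)
      omega
  have nC : CodeFP natE unE (fun N => Nat.log 2 N) := by
    have h1 : CodeFP natE unE (fun N => (natE N).length) := strLength.comp strOfNat
    have h2 : CodeFP unE unE (fun m => m - 1) :=
      (strDrop.comp ((CodeFP.const unE 1).pair strOfUn)).recodeOut fun m => by
        show (unE m).drop 1 = unE (m - 1)
        rw [unE_eq_ones, unE_eq_ones]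
        cases m with
        | zero => rfl
        | succ m => simp [ones, List.replicate_succ]
    exact (h2.comp h1).congr fun N => by
      show (natE N).length - 1 = Nat.log 2 N
      rw [length_natE, hlogsize]
  obtain ⟨updT, hupdT⟩ : ∃ updT : ℕ → List (Bool × ℕ × List Bool) → Bool → List (Bool × ℕ × List Bool),
      updT = fun N l b => [stepT (Nat.log 2 N) (s (Nat.log 2 N)) (l.headD (true, 0, [])) b] :=
    ⟨_, rfl⟩
  have UPD : CodeFP (pairE natE (pairE (rawE (pairE bitE (pairE natE strE))) bitE))
      (rawE (pairE bitE (pairE natE strE)))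
      (fun r : ℕ × List (Bool × ℕ × List Bool) × Bool => updT r.1 r.2.1 r.2.2) := by
    have rN : CodeFP (pairE natE (pairE (rawE (pairE bitE (pairE natE strE))) bitE)) natE
        (fun r : ℕ × List (Bool × ℕ × List Bool) × Bool => r.1) := CodeFP.fst _ _
    have rl : CodeFP (pairE natE (pairE (rawE (pairE bitE (pairE natE strE))) bitE))
        (rawE (pairE bitE (pairE natE strE)))
        (fun r : ℕ × List (Bool × ℕ × List Bool) × Bool => r.2.1) := (CodeFP.snd _ _).fst'
    have rb : CodeFP (pairE natE (pairE (rawE (pairE bitE (pairE natE strE))) bitE)) bitE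
        (fun r : ℕ × List (Bool × ℕ × List Bool) × Bool => r.2.2) := (CodeFP.snd _ _).snd'
    have rh : CodeFP (pairE natE (pairE (rawE (pairE bitE (pairE natE strE))) bitE))
        (pairE bitE (pairE natE strE))
        (fun r : ℕ × List (Bool × ℕ × List Bool) × Bool => r.2.1.headD (true, 0, [])) :=
      (rawHeadOr _).comp ((CodeFP.const _ (true, 0, ([] : List Bool))).pair rl)
    rw [hupdT]
    exact ((rawSingleton _).comp
      (stepC.comp (((nC.comp rN).pair (hs.comp (nC.comp rN))).pair (rh.pair rb))) :)
  obtain ⟨accT, haccT⟩ : ∃ accT : ℕ → List (Bool × ℕ × List Bool) → Bool,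
      accT = fun N l => !l.isEmpty && (l.headD (true, 0, [])).1 && decide (N = 2 ^ Nat.log 2 N) &&
        !decide (s (Nat.log 2 N) = 0) := ⟨_, rfl⟩
  have ACC : CodeFP (pairE natE (rawE (pairE bitE (pairE natE strE)))) bitE
      (fun r : ℕ × List (Bool × ℕ × List Bool) => accT r.1 r.2) := by
    have rN : CodeFP (pairE natE (rawE (pairE bitE (pairE natE strE)))) natE
        (fun r : ℕ × List (Bool × ℕ × List Bool) => r.1) := CodeFP.fst _ _
    have rl : CodeFP (pairE natE (rawE (pairE bitE (pairE natE strE))))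
        (rawE (pairE bitE (pairE natE strE)))
        (fun r : ℕ × List (Bool × ℕ × List Bool) => r.2) := CodeFP.snd _ _
    have rh : CodeFP (pairE natE (rawE (pairE bitE (pairE natE strE)))) (pairE bitE (pairE natE strE))
        (fun r : ℕ × List (Bool × ℕ × List Bool) => r.2.headD (true, 0, [])) :=
      (rawHeadOr _).comp ((CodeFP.const _ (true, 0, ([] : List Bool))).pair rl)
    rw [haccT]
    exact (((((rawIsEmpty _).comp rl).not.and rh.fst').and
      (natEq.comp₂ rN (natPow.comp₂ (CodeFP.const _ 2) (nC.comp rN)))).and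
      (((CodeFP.eq unE_injective).comp₂ (hs.comp (nC.comp rN)) (CodeFP.const _ 0)).not) :)
  /- Step 5: the streaming algorithm. -/
  obtain ⟨U, hUFP, hU⟩ := UPD
  obtain ⟨V, hVFP, hV⟩ := ACC
  obtain ⟨A, hA⟩ : ∃ A : StreamingAlgorithm, A =
      { init := fun _ => []
        update := fun N st b => U (boolPair (encodeNat N) (boolPair st [b]))
        accept := fun N st => (V (boolPair (encodeNat N) st)).headD false } := ⟨_, rfl⟩
  have hA_init : ∀ N, A.init N = [] := fun N => by rw [hA]
  have hA_upd : ∀ N st b, A.update N st b = U (boolPair (encodeNat N) (boolPair st [b])) :=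
    fun _ _ _ => by rw [hA]
  have hA_acc : ∀ N st, A.accept N st = (V (boolPair (encodeNat N) st)).headD false :=
    fun _ _ => by rw [hA]
  -- the typed trajectory
  obtain ⟨trajG, htrajG⟩ : ∃ trajG : ℕ → ℕ → List Bool → List (Bool × ℕ × List Bool),
      trajG = fun n σ x => x.foldl (fun l b => [stepT n σ (l.headD (true, 0, [])) b]) [] := ⟨_, rfl⟩
  have htrajG_nil : ∀ n σ, trajG n σ [] = [] := fun n σ => by rw [htrajG]; rfl
  have htrajG_snoc : ∀ n σ x b,
      trajG n σ (x ++ [b]) = [stepT n σ ((trajG n σ x).headD (true, 0, [])) b] := by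
    intro n σ x b
    rw [htrajG]
    simp only [List.foldl_append, List.foldl_cons, List.foldl_nil]
  have hupd_typed : ∀ (N : ℕ) (l : List (Bool × ℕ × List Bool)) (b : Bool),
      U (boolPair (encodeNat N) (boolPair (rawE (pairE bitE (pairE natE strE)) l) [b])) =
        rawE (pairE bitE (pairE natE strE))
          [stepT (Nat.log 2 N) (s (Nat.log 2 N)) (l.headD (true, 0, [])) b] := by
    intro N l b
    have h : U (boolPair (encodeNat N) (boolPair (rawE (pairE bitE (pairE natE strE)) l) [b])) =
        rawE (pairE bitE (pairE natE strE)) (updT N l b) := hU (N, l, b)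
    rw [h, hupdT]
  have hreach : ∀ N x, reach A N x =
      rawE (pairE bitE (pairE natE strE)) (trajG (Nat.log 2 N) (s (Nat.log 2 N)) x) := by
    intro N x
    induction x using List.reverseRecOn with
    | nil => rw [reach_nil, htrajG_nil, hA_init]; rfl
    | append_singleton x b ih => rw [reach_append_singleton, ih, hA_upd, htrajG_snoc, hupd_typed]
  have hacc_typed : ∀ (N : ℕ) (l : List (Bool × ℕ × List Bool)),
      V (boolPair (encodeNat N) (rawE (pairE bitE (pairE natE strE)) l)) = [accT N l] :=
    fun N l => hV (N, l)
  /- Step 6: the invariant of the trajectory. -/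
  obtain ⟨good, hgood⟩ : ∃ good : ℕ → ℕ → List Bool → Prop,
      good = fun n σ D => isClean D = true ∧ tabCount D ≤ σ ∧ D.length ≤ cap n σ := ⟨_, rfl⟩
  obtain ⟨Cons, hCons⟩ : ∃ Cons : ℕ → List Bool → List Bool → Prop,
      Cons = fun n D x => ∀ (j : ℕ) (hj : j < x.length), ev n D j = [x[j]] := ⟨_, rfl⟩
  have hCons_left : ∀ n D x b, Cons n D (x ++ [b]) → Cons n D x := by
    intro n D x b h
    rw [hCons] at h ⊢
    intro j hj
    rw [h j (by simp; omega)]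
    simp [List.getElem_append_left hj]
  have hgood_nil : ∀ n σ, good n σ [] := fun n σ => by
    rw [hgood]; exact ⟨by simp, by simp, by simp⟩
  have hINV : ∀ (n σ : ℕ) (x : List Bool), x ≠ [] →
      ∃ (a : Bool) (D : List Bool), trajG n σ x = [(a, x.length, D)] ∧
        (a = true → good n σ D ∧ Cons n D x) ∧
        ((∃ D₀, good n σ D₀ ∧ Cons n D₀ x) → a = true) ∧ (a = false → D = []) := by
    intro n σ x
    induction x using List.reverseRecOn with
    | nil => intro h; exact absurd rfl h
    | append_singleton x b ih =>
      intro _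
      obtain ⟨a, D, hhead, hP1, hP2⟩ : ∃ (a : Bool) (D : List Bool),
          (trajG n σ x).headD (true, 0, []) = (a, x.length, D) ∧
          (a = true → good n σ D ∧ Cons n D x) ∧ ((∃ D₀, good n σ D₀ ∧ Cons n D₀ x) → a = true) := by
        rcases eq_or_ne x [] with rfl | hx
        · refine ⟨true, [], by rw [htrajG_nil]; rfl, fun _ => ⟨hgood_nil n σ, ?_⟩, fun _ => rfl⟩
          rw [hCons]; intro j hj; simp at hj
        · obtain ⟨a, D, ht, h1, h2, -⟩ := ih hx
          exact ⟨a, D, by rw [ht]; rfl, h1, h2⟩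
      rw [htrajG_snoc, hhead, hstepT]
      dsimp only
      cases a with
      | false =>
        rw [if_neg Bool.false_ne_true]
        refine ⟨false, [], by rw [List.length_append, List.length_singleton], by simp, ?_, fun _ => rfl⟩
        rintro ⟨D₀, hg₀, hc₀⟩
        exact absurd (hP2 ⟨D₀, hg₀, hCons_left n D₀ x b hc₀⟩) (by simp)
      | true =>
        obtain ⟨hgD, hcD⟩ := hP1 rfl
        rw [if_pos rfl]
        by_cases htest : GOOD.boolIndicator (boolPair
            (pairE unE (pairE unE (pairE natE (pairE strE bitE))) (n, σ, x.length, D, b))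
            (g (pairE unE (pairE unE (pairE natE (pairE strE bitE))) (n, σ, x.length, D, b)))) = true
        · -- the search succeeded: the new program is good and consistent with one more bit
          rw [if_pos htest]
          have hmem := (Set.mem_iff_boolIndicator _ _).2 htest
          obtain ⟨hc', ht', hl', hvi, hvj⟩ := (hGiff n σ x.length D b _).1 hmem
          refine ⟨true, g (pairE unE (pairE unE (pairE natE (pairE strE bitE))) (n, σ, x.length, D, b)),
            by rw [List.length_append, List.length_singleton],
            fun _ => ⟨by rw [hgood]; exact ⟨hc', ht', hl'⟩, ?_⟩, fun _ => rfl, by simp⟩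
          rw [hCons] at hcD ⊢
          intro j hj
          rw [List.length_append, List.length_singleton] at hj
          rcases Nat.lt_succ_iff_lt_or_eq.1 hj with hj' | rfl
          · rw [hvj j hj', hcD j hj']; simp [List.getElem_append_left hj']
          · rw [hvi]; simp
        · -- the search failed: no good consistent program exists
          rw [if_neg htest]
          refine ⟨false, [], by rw [List.length_append, List.length_singleton], by simp, ?_, fun _ => rfl⟩
          rintro ⟨D₀, hg₀, hc₀⟩
          exfalso
          apply htest
          rw [← Set.mem_iff_boolIndicator]
          refine (hg _ ⟨D₀, ?_, ?_⟩).2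
          · rw [hgood] at hg₀; exact hg₀.2.2.trans (hcapW n σ x.length D b)
          · refine (hGiff n σ x.length D b D₀).2 ?_
            rw [hgood] at hg₀
            rw [hCons] at hc₀ hcD
            refine ⟨hg₀.1, hg₀.2.1, hg₀.2.2, ?_, fun j hj => ?_⟩
            · have := hc₀ x.length (by simp); simpa using this
            · rw [hc₀ j (by simp; omega), hcD j hj]; simp [List.getElem_append_left hj]
  /- Step 7: the algorithm decides `MCSP[s]`. -/
  have hdec : A.Decides (MCSPSize s) := by
    intro x
    show A.accept x.length (A.finalState x) = true ↔ x ∈ MCSPSize s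
    rw [finalState_eq_reach, hreach, hA_acc, hacc_typed, List.headD_cons, haccT]
    dsimp only
    rcases eq_or_ne x [] with rfl | hx
    · rw [htrajG_nil]
      simp only [List.isEmpty_nil, Bool.not_true, Bool.false_and, Bool.false_eq_true, false_iff]
      rintro ⟨n', f, h, -⟩
      have := congrArg List.length h
      rw [List.length_nil, length_truthTable] at this
      exact absurd this.symm (Nat.two_pow_pos n').ne'
    · obtain ⟨a, D, ht, hP1, hP2, -⟩ := hINV (Nat.log 2 x.length) (s (Nat.log 2 x.length)) x hx
      rw [ht]
      simp only [List.isEmpty_cons, Bool.not_false, Bool.true_and, List.headD_cons, Bool.and_eq_true,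
        decide_eq_true_eq, Bool.not_eq_true', decide_eq_false_iff_not]
      constructor
      · -- soundness: Theorem R
        rintro ⟨⟨ha, hN⟩, hσ⟩
        obtain ⟨hgD, hcD⟩ := hP1 ha
        rw [hgood] at hgD
        rw [hCons] at hcD
        set n := Nat.log 2 x.length with hn
        set f : (Fin n → Bool) → Bool := ofTruthTable x hN with hf
        have hxf : x = truthTable f := (truthTable_ofTruthTable x hN).symm
        obtain ⟨C, hB, hsize, hC⟩ := exists_circuit_evalFn n D hgD.1
        have hfv : ∀ v : Fin n → Bool, C.eval v = f v := by
          intro v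
          have hi := (boolFunEquivFin n v).isLt
          have hv : lowBits n (boolFunEquivFin n v) = v := by
            rw [← MCSPVerif.boolFunEquivFin_symm_apply, Equiv.symm_apply_apply]
          have h1 := hcD (boolFunEquivFin n v) (by rw [hN]; exact hi)
          rw [hev] at h1
          dsimp only at h1
          rw [takeD_encodeNat, hv, hC] at h1
          have h2 : f v = x[(boolFunEquivFin n v : ℕ)] := by simp [hf, ofTruthTable]
          rw [h2]
          simpa using h1
        rw [hxf, truthTable_mem_MCSPSize_iff]
        exact (circuitSizeOver_le_of_computes C hB hfv).trans
          (hsize.trans (max_le hgD.2.1 (Nat.one_le_iff_ne_zero.2 hσ)))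
      · -- completeness: an optimal circuit gives a good consistent program
        rintro ⟨n', f, rfl, hsf⟩
        have hn : Nat.log 2 (truthTable f).length = n' := by
          rw [length_truthTable, Nat.log_pow Nat.one_lt_two]
        rw [hn] at hP2 ⊢
        obtain ⟨C₀, hB₀, -, hC₀⟩ := (cktSize_univ_fin n' fun v (_ : Unit) => f v).toCircuit
        obtain ⟨C, hB, hCf, hCs⟩ := exists_circuit_size_eq_circuitSizeOver ⟨C₀, hB₀, hC₀⟩
        have hCle : C.size ≤ s n' := hCs ▸ hsf
        have hrow : ∀ D₀ : List Bool, (∀ v, evalFn (boolPair (List.ofFn v) D₀) = [f v]) →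
            Cons n' D₀ (truthTable f) := by
          intro D₀ hD₀
          rw [hCons]
          intro j hj
          rw [hev]
          dsimp only
          rw [takeD_encodeNat, hD₀, MCSPVerif.getElem_truthTable]
        by_cases h0 : C.size = 0
        · -- no gate: `f` is a projection, computed by a rotation code
          have hg : C.gates = [] := List.eq_nil_of_length_eq_zero h0
          obtain ⟨j, hj⟩ : ∃ j : Fin n', C.output = .inl j := by
            cases ho : C.output with
            | inl j => exact ⟨j, rfl⟩
            | inr m => exact absurd (C.wf_output m ho) (by simp [hg])
          have hfj : ∀ v, f v = v j := fun v => by rw [← hCf v]; simp [Circuit.eval, hj]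
          have hjn : (j : ℕ) < n' := j.isLt
          refine ⟨⟨hP2 ⟨rotCode (n' - 1 - j), ?_, hrow _ fun v => ?_⟩, length_truthTable f⟩, ?_⟩
          · rw [hgood]
            refine ⟨isClean_rotCode _, by rw [tabCount_rotCode]; exact Nat.zero_le _, ?_⟩
            rw [length_rotCode, hcap]
            dsimp only
            omega
          · rw [evalFn_boolPair, vmSpec_rotCode_proj (n' - 1 - j) (by omega), hfj]
            congr 2
            exact Fin.ext (by simp; omega)
          · have := hsn n'; omega
        · -- at least one gate: the program of `C`
          refine ⟨⟨hP2 ⟨progOf C, ?_, hrow _ fun v => ?_⟩, length_truthTable f⟩, by omega⟩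
          · rw [hgood]
            refine ⟨isClean_progOf C, by rw [tabCount_progOf]; exact hCle, ?_⟩
            refine (length_progOf_le C).trans ?_
            rw [hcap]
            dsimp only
            exact (Nat.mul_le_mul (by omega) (by omega)).trans (Nat.le_add_right _ _)
          · rw [evalFn_boolPair, vmSpec_progOf C (arity_le_of_isOver hB), hCf]
  /- Step 8: resource bounds. -/
  have hpoly : ∀ q : Polynomial ℕ, ∃ e : ℕ, ∀ m, q.eval m ≤ m ^ e + e := by
    intro q
    obtain ⟨d, C, h⟩ := exists_eval_le_pow_add q
    refine ⟨d + C + 1, fun m => (h m).trans ?_⟩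
    rcases Nat.eq_zero_or_pos m with rfl | hm
    · have h0 : (0 : ℕ) ^ d ≤ 1 := (Nat.pow_le_pow_left (Nat.zero_le 1) d).trans_eq (one_pow d)
      have h1 : (0 : ℕ) ^ (d + C + 1) = 0 := zero_pow (by omega)
      omega
    · exact Nat.add_le_add (Nat.pow_le_pow_right hm (by omega)) (by omega)
  have hmono : ∀ σ e e' : ℕ, e ≤ e' → σ ^ e + e ≤ σ ^ e' + e' := by
    intro σ e e' h
    rcases Nat.eq_zero_or_pos σ with rfl | hσ
    · rcases Nat.eq_zero_or_pos e with rfl | he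
      · rcases Nat.eq_zero_or_pos e' with rfl | he'
        · simp
        · have : (0 : ℕ) ^ e' = 0 := zero_pow he'.ne'
          simp only [pow_zero]
          omega
      · have h1 : (0 : ℕ) ^ e = 0 := zero_pow he.ne'
        have h2 : (0 : ℕ) ^ e' = 0 := zero_pow (by omega)
        omega
    · exact Nat.add_le_add (Nat.pow_le_pow_right hσ h) h
  have hcap_mono : ∀ n σ, n ≤ σ → cap n σ ≤ cap σ σ := by
    intro n σ h
    rw [hcap]
    dsimp only
    have := Nat.mul_le_mul_left (σ + 1) (show 8 * (n + σ) + 10 ≤ 8 * (σ + σ) + 10 by omega)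
    omega
  have hspace : ∀ (N : ℕ) (x : List Bool), x.length ≤ N →
      (reach A N x).length ≤ 18 + 4 * s (Nat.log 2 N) + 2 * cap (s (Nat.log 2 N)) (s (Nat.log 2 N)) := by
    intro N x hxN
    rw [hreach]
    rcases eq_or_ne x [] with rfl | hx
    · rw [htrajG_nil, rawE_nil]; exact Nat.zero_le _
    · obtain ⟨a, D, ht, hP1, -, hP3⟩ := hINV _ _ x hx
      rw [ht]
      have hn : Nat.log 2 N ≤ s (Nat.log 2 N) := hsn _
      have hi : (natE x.length).length ≤ Nat.log 2 N + 1 :=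
        (TM2Pass.length_encodeNat_le x.length).trans
          (Nat.add_le_add_right (Nat.log_mono_right hxN) 1)
      have hD : D.length ≤ cap (s (Nat.log 2 N)) (s (Nat.log 2 N)) := by
        cases a with
        | true => rw [hgood] at hP1; exact (hP1 rfl).1.2.2.trans (hcap_mono _ _ hn)
        | false => rw [hP3 rfl]; exact Nat.zero_le _
      simp only [rawE_cons, rawE_nil, pairE_apply, length_boolPair, bitE, strE, id_eq,
        List.length_singleton, List.length_nil]
      omega
  obtain ⟨pU, MU, hMU⟩ := hUFP
  obtain ⟨pV, MV, hMV⟩ := hVFP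
  have hB₁ : ∀ σ, 18 + 4 * σ + 2 * cap σ σ =
      (18 + 4 * X + 2 * ((X + 1) * (8 * (X + X) + 10) + 2 * X) : Polynomial ℕ).eval σ := by
    intro σ
    rw [hcap]
    simp only [eval_add, eval_mul, eval_X, eval_ofNat, eval_one]
  have hB₂ : ∀ σ, 2 * (σ + 1) + 2 + (2 * (18 + 4 * σ + 2 * cap σ σ) + 2 + 1) =
      (2 * (X + 1) + 2 + (2 * (18 + 4 * X + 2 * ((X + 1) * (8 * (X + X) + 10) + 2 * X)) + 2 + 1) :
        Polynomial ℕ).eval σ := by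
    intro σ
    rw [hcap]
    simp only [eval_add, eval_mul, eval_X, eval_ofNat, eval_one]
  obtain ⟨e₁, he₁⟩ := hpoly (18 + 4 * X + 2 * ((X + 1) * (8 * (X + X) + 10) + 2 * X))
  obtain ⟨e₂, he₂⟩ := hpoly (pU.comp
    (2 * (X + 1) + 2 + (2 * (18 + 4 * X + 2 * ((X + 1) * (8 * (X + X) + 10) + 2 * X)) + 2 + 1)))
  obtain ⟨e₃, he₃⟩ := hpoly (pV.comp
    (2 * (X + 1) + 2 + (2 * (18 + 4 * X + 2 * ((X + 1) * (8 * (X + X) + 10) + 2 * X)) + 2 + 1)))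
  have hinlen : ∀ (N : ℕ) (x w : List Bool), x.length ≤ N → w.length ≤ 1 →
      (boolPair (encodeNat N) (boolPair (reach A N x) w)).length ≤
        (2 * (X + 1) + 2 + (2 * (18 + 4 * X + 2 * ((X + 1) * (8 * (X + X) + 10) + 2 * X)) + 2 + 1) :
          Polynomial ℕ).eval (s (Nat.log 2 N)) := by
    intro N x w hx hw
    rw [← hB₂]
    have h1 := hspace N x hx
    have h2 : (encodeNat N).length ≤ Nat.log 2 N + 1 := TM2Pass.length_encodeNat_le N
    have h3 := hsn (Nat.log 2 N)
    simp only [length_boolPair]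
    omega
  have hinlen' : ∀ (N : ℕ) (x : List Bool), x.length ≤ N →
      (boolPair (encodeNat N) (reach A N x)).length ≤
        (2 * (X + 1) + 2 + (2 * (18 + 4 * X + 2 * ((X + 1) * (8 * (X + X) + 10) + 2 * X)) + 2 + 1) :
          Polynomial ℕ).eval (s (Nat.log 2 N)) := by
    intro N x hx
    refine le_trans ?_ (hinlen N x [] hx (by simp))
    simp only [length_boolPair, List.length_nil]
    omega
  refine ⟨e₁ + e₂ + e₃, A, hA_init, fun N x hx => ?_, ⟨MU, fun N x b hx => ?_⟩, ⟨MV, fun x => ?_⟩, hdec⟩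
  · -- space
    exact (hspace N x hx).trans ((hB₁ _).trans_le ((he₁ _).trans (hmono _ _ _ (by omega))))
  · -- update time
    rw [reach_append_singleton, hA_upd]
    refine (hMU _).mono ?_
    show pU.eval (boolPair (encodeNat N) (boolPair (reach A N x) [b])).length ≤ _
    calc pU.eval (boolPair (encodeNat N) (boolPair (reach A N x) [b])).length
        ≤ pU.eval ((2 * (X + 1) + 2 + (2 * (18 + 4 * X + 2 * ((X + 1) * (8 * (X + X) + 10) + 2 * X))
            + 2 + 1) : Polynomial ℕ).eval (s (Nat.log 2 N))) :=
          TM2Iter.eval_mono pU (hinlen N x [b] hx.le (by simp))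
      _ ≤ s (Nat.log 2 N) ^ e₂ + e₂ := by rw [← eval_comp]; exact he₂ _
      _ ≤ _ := hmono _ _ _ (by omega)
  · -- report time
    rw [finalState_eq_reach]
    have hVz : V (boolPair (encodeNat x.length) (reach A x.length x)) =
        [A.accept x.length (reach A x.length x)] := by
      rw [hA_acc, hreach, hacc_typed, List.headD_cons]
    rw [← hVz]
    refine (hMV _).mono ?_
    show pV.eval (boolPair (encodeNat x.length) (reach A x.length x)).length ≤ _
    calc pV.eval (boolPair (encodeNat x.length) (reach A x.length x)).length
        ≤ pV.eval ((2 * (X + 1) + 2 + (2 * (18 + 4 * X + 2 * ((X + 1) * (8 * (X + X) + 10) + 2 * X))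
            + 2 + 1) : Polynomial ℕ).eval (s (Nat.log 2 x.length))) :=
          TM2Iter.eval_mono pV (hinlen' x.length x le_rfl)
      _ ≤ s (Nat.log 2 x.length) ^ e₃ + e₃ := by rw [← eval_comp]; exact he₃ _
      _ ≤ _ := hmono _ _ _ (by omega)

/-- **[MMW19, Thm. 1.3] for polynomially honest `s` (the magnification statement).**  If `s` is
polynomial-time computable from unary to unary, `n ≤ s n`, and `MCSP[s]` has no uniform
`poly(s(n))`-space `poly(s(n))`-update-time one-pass streaming algorithm, then `P ≠ NP`.
[cite: McKayMurrayWilliams2019, Thm. 1.3] -/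
theorem P_ne_NP_of_streamingLowerBound_of_codeFP {s : ℕ → ℕ} (hs : CodeFP unE unE s)
    (hsn : ∀ n, n ≤ s n) (h : StreamingLowerBound s) :
    Classes.P ≠ Nondeterministic.NP := by
  intro hPNP
  have hNP : Nondeterministic.NP ⊆ Classes.P := fun L hL => by rw [hPNP]; exact hL
  obtain ⟨c, hc⟩ := MCSPSize_mem_USTREAM_of_NP_subset_P hNP hs hsn
  exact h c hc

/-- The same, concluding `¬ (NP ⊆ P)`. [cite: McKayMurrayWilliams2019, Thm. 1.3] -/
theorem not_NP_subset_P_of_streamingLowerBound_of_codeFP {s : ℕ → ℕ} (hs : CodeFP unE unE s)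
    (hsn : ∀ n, n ≤ s n) (h : StreamingLowerBound s) :
    ¬ (Nondeterministic.NP ⊆ Classes.P) := fun hNP => by
  obtain ⟨c, hc⟩ := MCSPSize_mem_USTREAM_of_NP_subset_P hNP hs hsn
  exact h c hc

/-- **`thm13` on the polynomially honest range**, in the binder shape of the named fact `thm13`
(with `IsTimeConstructible s` replaced by unary polynomial-time computability and `n ≤ s n`).
[cite: McKayMurrayWilliams2019, Thm. 1.3] -/
theorem thm13_of_codeFP : ∀ s : ℕ → ℕ, CodeFP unE unE s → (∀ n, n ≤ s n) → StreamingLowerBound s →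
    Classes.P ≠ Nondeterministic.NP :=
  fun _ hs hsn h => P_ne_NP_of_streamingLowerBound_of_codeFP hs hsn h

/-- **[MMW19, Thm. 1.3] for `s(n) = n ^ k`, `k ≥ 1`** — the instances in which the theorem is
applied (e.g. `s(n) = n^{k}` for large `k` against `N · polylog`-type streaming bounds): a
`poly(n^k)` uniform streaming lower bound for `MCSP[n^k]` implies `P ≠ NP`.
[cite: McKayMurrayWilliams2019, Thm. 1.3] -/
theorem thm13_pow (k : ℕ) (hk : 1 ≤ k) (h : StreamingLowerBound (fun n => n ^ k)) :
    Classes.P ≠ Nondeterministic.NP :=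
  P_ne_NP_of_streamingLowerBound_of_codeFP
    (((ulength unitE).comp (unitsPow k)).congr fun n => by simp)
    (fun n => Nat.le_self_pow (by omega) n) h

end Literature.Computability.MetaComplexity.McKayMurrayWilliams2019
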